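import Mathlib
import Summits.NavierStokesRegularity.NavierStokesRegularity.Theorems.L3TimeExponentPincerRingDatumEtaSupport
import Summits.NavierStokesRegularity.NavierStokesRegularity.Theorems.L3TimeExponentPincerRingDatumMoments
import Summits.NavierStokesRegularity.NavierStokesRegularity.Theorems.L3TimeExponentPincerRingDatumShape
import Summits.NavierStokesRegularity.NavierStokesRegularity.Theorems.L3TimeExponentPincerRingDatumPotential
import HarnessLib.Audit
import HarnessLib

/-!
# L3TimeExponentPincer — ring datum calculus XVI: the glued-dipole datum at core scale `t⁴`,
# all hypotheses of `lpPersistence_of_ringData` in closed form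

Support kernel for the crux `L3CascadeJaw` (item stmt-NavierStokesRegularity-19499).  The explicit
ring datum of the ring Persistence Lemma is

  `u₀ = curl (F(|x|²) J)`,  `F(s) = ∫_{32}^{s} τ^{-5/2} G(τ) dτ`,
  `G(s) = −κ (φ(s/t⁴ − 1) − φ(s/16 − 1))`,  `φ = Real.smoothTransition`,

with core scale `a = t⁴` (`t = √ℓ ∈ (0, 1]`), outer scale `b = 16`, cut-off `R = 32`, strength
`κ ≥ 0`.  This file collects, for this datum, every datum-side hypothesis of
`lpPersistence_of_ringData` (`…RingPersistence`) as a closed-form bound in the letters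
`κ, t, Φ, V₁` (`Φ` any bound of `|φ'|`, `V₁ = volume.real (ball 0 1)`), by instantiating the tree lemmas of `…RingDatum{Frame, Eta,
EtaSupport, Shape, Potential, Profile, Moments, Measure, SpeedBound, DecayIntegral, PolarBall,
EnergyFloor}`:

* `ringDatum_frame`, `ringDatum_integrable` — smooth, divergence free, rapidly decaying,
  axisymmetric without swirl, `ω_θ/r ∈ L¹`;
* `ringDatum_abs_eta_le` — `|ω_θ/r| ≤ 4Φκ/t¹⁰`; `ringDatum_eta_lower` — `−Φκ/256 ≤ ω_θ/r`;
  sign zones `ringDatum_eta_nonpos_of_ge` (`|x|² ≥ 2t⁴`), `ringDatum_eta_nonneg_of_le` (`|x|² ≤ 16`),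
  `ringDatum_eta_eq_zero_of_ge` (`|x|² ≥ 32`);
* `ringDatum_negPart_le` (`mneg = ΦκV₁`), `ringDatum_rsq_posPart_le` / `ringDatum_rsq_negPart_le`
  (`P = 128ΦκV₁`), `ringDatum_mass_le` (`m = 32ΦκV₁/t⁴ + ΦκV₁`);
* the energy bounds (`∫⁻‖u₀‖ₑ² ≤ ofReal ((6656/9) κ²/t⁶) · I₆`, `ofReal (κ²V₁/(144000 t⁶)) ≤ ∫⁻‖u₀‖ₑ²`)
  are in the sequel `…RingDatumEnergy`; the scale choice `κ = c_E t³` and the three scale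
  inequalities in `…RingPersistenceHolds`.  WHAT THIS IS NOT: not NS regularity or blow-up; explicit-datum
bookkeeping for a support lemma of a DRAFT route; no crux claim.
-/

namespace Summit.NavierStokesRegularity.NavierStokesRegularity.Theorems.L3TimeExponentPincerRingDatumBounds

open Real Set Metric MeasureTheory Literature.Analysis.FluidPDE Literature.Analysis.Calculus
open Summit.NavierStokesRegularity.NavierStokesRegularity.Theorems.L3TimeExponentPincerRingDatumEta
open Summit.NavierStokesRegularity.NavierStokesRegularity.Theorems.L3TimeExponentPincerRingDatumEtaSupport
open Summit.NavierStokesRegularity.NavierStokesRegularity.Theorems.L3TimeExponentPincerRingDatumMoments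
open Summit.NavierStokesRegularity.NavierStokesRegularity.Theorems.L3TimeExponentPincerRingDatumMeasure
open Summit.NavierStokesRegularity.NavierStokesRegularity.Theorems.L3TimeExponentPincerRingDatumShape
open Summit.NavierStokesRegularity.NavierStokesRegularity.Theorems.L3TimeExponentPincerRingDatumPotential
open Summit.NavierStokesRegularity.NavierStokesRegularity.Theorems.L3TimeExponentPincerRingDatumProfile
open Summit.NavierStokesRegularity.NavierStokesRegularity.Theorems.L3TimeExponentPincerRingDatumFrame
open scoped ENNReal ContDiff Topology

variable {G F : ℝ → ℝ} {κ t Φ : ℝ}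

/-! ### A. The shape function at `a = t⁴`, `b = 16` -/

/-- **Shell bound for `G'`** (general scales): `|G'(s)| ≤ κΦ/b` for `2a ≤ s` (`0 ≤ κ`, `0 < a ≤ b`). -/
theorem abs_deriv_shape_le_of_ge {a b : ℝ}
    (hG : G = fun s => -κ * (Real.smoothTransition (s / a - 1) - Real.smoothTransition (s / b - 1)))
    (hκ : 0 ≤ κ) (ha : 0 < a) (hab : a ≤ b) (hΦ : ∀ τ, |deriv Real.smoothTransition τ| ≤ Φ)
    {s : ℝ} (hs : 2 * a ≤ s) : |deriv G s| ≤ κ * Φ / b := by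
  have hb : 0 < b := ha.trans_le hab
  rw [deriv_shape hG, deriv_smoothTransition_of_one_le (t := s / a - 1) (by
      rw [le_sub_iff_add_le, le_div_iff₀ ha]; linarith), zero_div, zero_sub, abs_mul, abs_neg,
    abs_of_nonneg hκ, abs_neg, abs_div, abs_of_pos hb, mul_div_assoc]
  exact mul_le_mul_of_nonneg_left (div_le_div_of_nonneg_right (hΦ _) hb.le) hκ

/-- `0 < t⁴`, `t⁴ ≤ 16`, `2t⁴ ≤ 16` for `0 < t ≤ 1`. -/
theorem core_scale_bounds (ht : 0 < t) (ht1 : t ≤ 1) :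
    0 < t ^ 4 ∧ t ^ 4 ≤ 16 ∧ 2 * t ^ 4 ≤ 16 := by
  have h1 : t ^ 4 ≤ 1 := pow_le_one₀ ht.le ht1
  exact ⟨pow_pos ht 4, by linarith, by linarith⟩

/-- `(t⁴)^{-3/2} = (t⁶)⁻¹` for `0 < t`. -/
theorem rpow_pow_four_neg_three_halves (ht : 0 < t) : (t ^ 4) ^ (-(3 / 2 : ℝ)) = (t ^ 6)⁻¹ := by
  rw [← Real.rpow_natCast t 4, ← Real.rpow_mul ht.le,
    show ((4 : ℕ) : ℝ) * (-(3 / 2 : ℝ)) = -((6 : ℕ) : ℝ) by norm_num, Real.rpow_neg ht.le,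
    Real.rpow_natCast]

/-- `16^{-3/2} = 1/64`. -/
theorem rpow_sixteen_neg_three_halves : (16 : ℝ) ^ (-(3 / 2 : ℝ)) = 1 / 64 := by
  rw [show (16 : ℝ) = 2 ^ (4 : ℝ) by norm_num, ← Real.rpow_mul (by norm_num)]
  norm_num

/-! ### B. The potential `F = ∫_{32}^{s} τ^{-5/2} G` and the datum -/

section Datum

/-- The standing facts about `G` and `F` used below. -/
theorem potential_facts
    (hG : G = fun s => -κ * (Real.smoothTransition (s / t ^ 4 - 1) - Real.smoothTransition (s / 16 - 1)))
    (hF : F = fun s => ∫ τ in (32 : ℝ)..s, τ ^ (-(5 / 2 : ℝ)) * G τ) (ht : 0 < t) (ht1 : t ≤ 1) :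
    ContDiff ℝ ∞ G ∧ (∀ s, s ≤ t ^ 4 → G s = 0) ∧ (∀ s, 32 ≤ s → G s = 0) ∧
    ContDiff ℝ ∞ F ∧ (deriv F = fun s => s ^ (-(5 / 2 : ℝ)) * G s) ∧ (∀ s, 32 ≤ s → F s = 0) := by
  obtain ⟨ht4, hab, -⟩ := core_scale_bounds ht ht1
  have hGs : ContDiff ℝ ∞ G := contDiff_shape hG
  have hGa : ∀ s, s ≤ t ^ 4 → G s = 0 := fun s hs => shape_eq_zero_of_le hG ht4 hab hs
  have hGR : ∀ s, 32 ≤ s → G s = 0 := fun s hs =>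
    shape_eq_zero_of_ge hG ht4 hab (by linarith : 2 * (16 : ℝ) ≤ s)
  refine ⟨hGs, hGa, hGR, ?_, ?_, ?_⟩
  · rw [hF]; exact contDiff_potential hGs ht4 hGa
  · rw [hF]; exact deriv_potential hGs ht4 hGa
  · intro s hs; rw [hF]; exact potential_eq_zero_of_ge hGR hs

/-- **The datum is a frame datum**: smooth, divergence free, rapidly decaying, axisymmetric, no swirl. -/
theorem ringDatum_frame
    (hG : G = fun s => -κ * (Real.smoothTransition (s / t ^ 4 - 1) - Real.smoothTransition (s / 16 - 1)))
    (hF : F = fun s => ∫ τ in (32 : ℝ)..s, τ ^ (-(5 / 2 : ℝ)) * G τ) (ht : 0 < t) (ht1 : t ≤ 1) :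
    ContDiff ℝ ∞ (curl fun y : EuclideanSpace ℝ (Fin 3) => F (‖y‖ ^ 2) • rotGen y) ∧
    VectorCalculus.IsDivFree (curl fun y : EuclideanSpace ℝ (Fin 3) => F (‖y‖ ^ 2) • rotGen y) ∧
    HasRapidSpatialDecay (curl fun y : EuclideanSpace ℝ (Fin 3) => F (‖y‖ ^ 2) • rotGen y) ∧
    IsAxisymmetric (curl fun y : EuclideanSpace ℝ (Fin 3) => F (‖y‖ ^ 2) • rotGen y) ∧
    HasNoSwirl (curl fun y : EuclideanSpace ℝ (Fin 3) => F (‖y‖ ^ 2) • rotGen y) := by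
  obtain ⟨-, -, -, hFs, -, hF0⟩ := potential_facts hG hF ht ht1
  exact ringField_frame hFs (by norm_num) hF0

/-- **`ω_θ/r ∈ L¹`** for the datum. -/
theorem ringDatum_integrable
    (hG : G = fun s => -κ * (Real.smoothTransition (s / t ^ 4 - 1) - Real.smoothTransition (s / 16 - 1)))
    (hF : F = fun s => ∫ τ in (32 : ℝ)..s, τ ^ (-(5 / 2 : ℝ)) * G τ) (ht : 0 < t) (ht1 : t ≤ 1) :
    Integrable (angVortQuot (curl fun y : EuclideanSpace ℝ (Fin 3) => F (‖y‖ ^ 2) • rotGen y)) := by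
  obtain ⟨-, -, -, hFs, -, hF0⟩ := potential_facts hG hF ht ht1
  exact integrable_angVortQuot_ringField (hFs.of_le (by norm_cast)) (by norm_num) hF0

/-! ### C. Pointwise bounds and sign zones of `η₀ = ω_θ/r` -/

/-- **Sup bound** `|η₀| ≤ 4Φκ/t¹⁰` (the letter `M`). -/
theorem ringDatum_abs_eta_le
    (hG : G = fun s => -κ * (Real.smoothTransition (s / t ^ 4 - 1) - Real.smoothTransition (s / 16 - 1)))
    (hF : F = fun s => ∫ τ in (32 : ℝ)..s, τ ^ (-(5 / 2 : ℝ)) * G τ) (ht : 0 < t) (ht1 : t ≤ 1)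
    (hκ : 0 ≤ κ) (hΦ : ∀ τ, |deriv Real.smoothTransition τ| ≤ Φ) (x : EuclideanSpace ℝ (Fin 3)) :
    |angVortQuot (curl fun y : EuclideanSpace ℝ (Fin 3) => F (‖y‖ ^ 2) • rotGen y) x| ≤
      4 * Φ * κ / t ^ 10 := by
  obtain ⟨ht4, -, hab2⟩ := core_scale_bounds ht ht1
  obtain ⟨hGs, hGa, -, hFs, hF', -⟩ := potential_facts hG hF ht ht1
  have hD : ∀ s, |deriv G s| ≤ κ * Φ / t ^ 4 := abs_deriv_shape_le hG hκ ht4 hab2 hΦ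
  have h := abs_angVortQuot_ringField_le (hFs.of_le (by norm_cast)) hF'
    (hGs.differentiable (by simp)) ht4 hGa hD x
  rw [rpow_pow_four_neg_three_halves ht] at h
  have e : 4 * (t ^ 6)⁻¹ * (κ * Φ / t ^ 4) = 4 * Φ * κ / t ^ 10 := by
    rw [div_eq_mul_inv, div_eq_mul_inv, show (t ^ 10)⁻¹ = (t ^ 6)⁻¹ * (t ^ 4)⁻¹ by
      rw [← mul_inv, show t ^ 10 = t ^ 6 * t ^ 4 by ring]]
    ring
  rwa [e] at h

/-- **`η₀ ≤ 0` off the core**: `2t⁴ ≤ |x|²` ⇒ `η₀(x) ≤ 0`. -/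
theorem ringDatum_eta_nonpos_of_ge
    (hG : G = fun s => -κ * (Real.smoothTransition (s / t ^ 4 - 1) - Real.smoothTransition (s / 16 - 1)))
    (hF : F = fun s => ∫ τ in (32 : ℝ)..s, τ ^ (-(5 / 2 : ℝ)) * G τ) (ht : 0 < t) (ht1 : t ≤ 1)
    (hκ : 0 ≤ κ) {x : EuclideanSpace ℝ (Fin 3)} (hx : 2 * t ^ 4 ≤ ‖x‖ ^ 2) :
    angVortQuot (curl fun y : EuclideanSpace ℝ (Fin 3) => F (‖y‖ ^ 2) • rotGen y) x ≤ 0 := by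
  obtain ⟨ht4, hab, -⟩ := core_scale_bounds ht ht1
  obtain ⟨hGs, -, -, hFs, hF', -⟩ := potential_facts hG hF ht ht1
  exact angVortQuot_ringField_nonpos_of_ge (hFs.of_le (by norm_cast)) hF'
    (hGs.differentiable (by simp)) ht4 (fun s hs => deriv_shape_nonneg_of_ge hG hκ ht4 hab hs) hx

/-- **`η₀ ≥ 0` inside the outer scale**: `|x|² ≤ 16` ⇒ `0 ≤ η₀(x)`. -/
theorem ringDatum_eta_nonneg_of_le
    (hG : G = fun s => -κ * (Real.smoothTransition (s / t ^ 4 - 1) - Real.smoothTransition (s / 16 - 1)))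
    (hF : F = fun s => ∫ τ in (32 : ℝ)..s, τ ^ (-(5 / 2 : ℝ)) * G τ) (ht : 0 < t) (ht1 : t ≤ 1)
    (hκ : 0 ≤ κ) {x : EuclideanSpace ℝ (Fin 3)} (hx : ‖x‖ ^ 2 ≤ 16) :
    0 ≤ angVortQuot (curl fun y : EuclideanSpace ℝ (Fin 3) => F (‖y‖ ^ 2) • rotGen y) x := by
  obtain ⟨ht4, hab, -⟩ := core_scale_bounds ht ht1
  obtain ⟨hGs, hGa, -, hFs, hF', -⟩ := potential_facts hG hF ht ht1
  exact angVortQuot_ringField_nonneg_of_le (hFs.of_le (by norm_cast)) hF'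
    (hGs.differentiable (by simp)) ht4 hGa (fun s hs => deriv_shape_nonpos_of_le hG hκ ht4 hab hs) hx

/-- **Shell sup bound**: `16 ≤ |x|²` ⇒ `|η₀(x)| ≤ Φκ/256`. -/
theorem ringDatum_abs_eta_le_of_ge
    (hG : G = fun s => -κ * (Real.smoothTransition (s / t ^ 4 - 1) - Real.smoothTransition (s / 16 - 1)))
    (hF : F = fun s => ∫ τ in (32 : ℝ)..s, τ ^ (-(5 / 2 : ℝ)) * G τ) (ht : 0 < t) (ht1 : t ≤ 1)
    (hκ : 0 ≤ κ) (hΦ : ∀ τ, |deriv Real.smoothTransition τ| ≤ Φ) {x : EuclideanSpace ℝ (Fin 3)}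
    (hx : 16 ≤ ‖x‖ ^ 2) :
    |angVortQuot (curl fun y : EuclideanSpace ℝ (Fin 3) => F (‖y‖ ^ 2) • rotGen y) x| ≤
      Φ * κ / 256 := by
  obtain ⟨ht4, hab, hab2⟩ := core_scale_bounds ht ht1
  obtain ⟨hGs, -, -, hFs, hF', -⟩ := potential_facts hG hF ht ht1
  have hDs : ∀ s, 16 ≤ s → |deriv G s| ≤ κ * Φ / 16 := fun s hs =>
    abs_deriv_shape_le_of_ge hG hκ ht4 hab hΦ (by linarith)
  have h := abs_angVortQuot_ringField_le_of_ge (hFs.of_le (by norm_cast)) hF'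
    (hGs.differentiable (by simp)) (by norm_num : (0 : ℝ) < 16) hDs hx
  rw [rpow_sixteen_neg_three_halves] at h
  have e : 4 * (1 / 64 : ℝ) * (κ * Φ / 16) = Φ * κ / 256 := by ring
  rwa [e] at h

/-- **`η₀ = 0` beyond the shell**: `32 ≤ |x|²` ⇒ `η₀(x) = 0`. -/
theorem ringDatum_eta_eq_zero_of_ge
    (hG : G = fun s => -κ * (Real.smoothTransition (s / t ^ 4 - 1) - Real.smoothTransition (s / 16 - 1)))
    (hF : F = fun s => ∫ τ in (32 : ℝ)..s, τ ^ (-(5 / 2 : ℝ)) * G τ) (ht : 0 < t) (ht1 : t ≤ 1)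
    {x : EuclideanSpace ℝ (Fin 3)} (hx : 32 ≤ ‖x‖ ^ 2) :
    angVortQuot (curl fun y : EuclideanSpace ℝ (Fin 3) => F (‖y‖ ^ 2) • rotGen y) x = 0 := by
  obtain ⟨ht4, hab, -⟩ := core_scale_bounds ht ht1
  obtain ⟨hGs, -, -, hFs, hF', -⟩ := potential_facts hG hF ht ht1
  exact angVortQuot_ringField_eq_zero_of_ge (hFs.of_le (by norm_cast)) hF'
    (hGs.differentiable (by simp)) (by norm_num : (0 : ℝ) < 16)
    (fun s hs => deriv_shape_eq_zero_of_ge hG ht4 hab hs) (by linarith)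

/-- **Lower bound everywhere**: `−Φκ/256 ≤ η₀(x)`. -/
theorem ringDatum_eta_lower
    (hG : G = fun s => -κ * (Real.smoothTransition (s / t ^ 4 - 1) - Real.smoothTransition (s / 16 - 1)))
    (hF : F = fun s => ∫ τ in (32 : ℝ)..s, τ ^ (-(5 / 2 : ℝ)) * G τ) (ht : 0 < t) (ht1 : t ≤ 1)
    (hκ : 0 ≤ κ) (hΦ : ∀ τ, |deriv Real.smoothTransition τ| ≤ Φ) (x : EuclideanSpace ℝ (Fin 3)) :
    -(Φ * κ / 256) ≤ angVortQuot (curl fun y : EuclideanSpace ℝ (Fin 3) => F (‖y‖ ^ 2) • rotGen y) x := by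
  rcases le_or_gt (‖x‖ ^ 2) 16 with hx | hx
  · have hΦ0 : 0 ≤ Φ := (abs_nonneg _).trans (hΦ 0)
    have h0 := ringDatum_eta_nonneg_of_le hG hF ht ht1 hκ hx
    have : 0 ≤ Φ * κ / 256 := by positivity
    linarith
  · exact (abs_le.1 (ringDatum_abs_eta_le_of_ge hG hF ht ht1 hκ hΦ hx.le)).1

/-- `η₀ ≥ 0` off the closed ball of radius `6` (indeed `η₀ = 0` there). -/
theorem ringDatum_eta_nonneg_of_six_lt
    (hG : G = fun s => -κ * (Real.smoothTransition (s / t ^ 4 - 1) - Real.smoothTransition (s / 16 - 1)))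
    (hF : F = fun s => ∫ τ in (32 : ℝ)..s, τ ^ (-(5 / 2 : ℝ)) * G τ) (ht : 0 < t) (ht1 : t ≤ 1)
    {x : EuclideanSpace ℝ (Fin 3)} (hx : 6 < ‖x‖) :
    0 ≤ angVortQuot (curl fun y : EuclideanSpace ℝ (Fin 3) => F (‖y‖ ^ 2) • rotGen y) x := by
  rw [ringDatum_eta_eq_zero_of_ge hG hF ht ht1 (by nlinarith [norm_nonneg x])]

/-- `η₀ ≤ 0` off the closed ball of radius `2t²`. -/
theorem ringDatum_eta_nonpos_of_lt
    (hG : G = fun s => -κ * (Real.smoothTransition (s / t ^ 4 - 1) - Real.smoothTransition (s / 16 - 1)))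
    (hF : F = fun s => ∫ τ in (32 : ℝ)..s, τ ^ (-(5 / 2 : ℝ)) * G τ) (ht : 0 < t) (ht1 : t ≤ 1)
    (hκ : 0 ≤ κ) {x : EuclideanSpace ℝ (Fin 3)} (hx : 2 * t ^ 2 < ‖x‖) :
    angVortQuot (curl fun y : EuclideanSpace ℝ (Fin 3) => F (‖y‖ ^ 2) • rotGen y) x ≤ 0 := by
  have ht2 : 0 ≤ 2 * t ^ 2 := by positivity
  have h4 : (2 * t ^ 2) ^ 2 < ‖x‖ ^ 2 := by nlinarith [norm_nonneg x]
  exact ringDatum_eta_nonpos_of_ge hG hF ht ht1 hκ (by nlinarith [pow_pos ht 4])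

/-! ### D. The moment hypotheses `mneg`, `P`, `m` -/

/-- **`mneg`**: `∫⁻ η₀⁻ ≤ ofReal (Φ κ V₁)`. -/
theorem ringDatum_negPart_le
    (hG : G = fun s => -κ * (Real.smoothTransition (s / t ^ 4 - 1) - Real.smoothTransition (s / 16 - 1)))
    (hF : F = fun s => ∫ τ in (32 : ℝ)..s, τ ^ (-(5 / 2 : ℝ)) * G τ) (ht : 0 < t) (ht1 : t ≤ 1)
    (hκ : 0 ≤ κ) (hΦ : ∀ τ, |deriv Real.smoothTransition τ| ≤ Φ) :
    ∫⁻ x, ENNReal.ofReal ((angVortQuot (curl fun y : EuclideanSpace ℝ (Fin 3) => F (‖y‖ ^ 2) • rotGen y) x)⁻) ≤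
      ENNReal.ofReal (Φ * κ * (volume (ball (0 : EuclideanSpace ℝ (Fin 3)) 1)).toReal) := by
  have hΦ0 : 0 ≤ Φ := (abs_nonneg _).trans (hΦ 0)
  have h := lintegral_negPart_le (η := angVortQuot (curl fun y : EuclideanSpace ℝ (Fin 3) =>
      F (‖y‖ ^ 2) • rotGen y)) (Ms := Φ * κ / 256) (ρs := 6) (by positivity) (by norm_num)
    (fun x => ringDatum_eta_lower hG hF ht ht1 hκ hΦ x)
    (fun x hx => ringDatum_eta_nonneg_of_six_lt hG hF ht ht1 hx)
  refine h.trans (ENNReal.ofReal_le_ofReal ?_)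
  have hV : 0 ≤ (volume (ball (0 : EuclideanSpace ℝ (Fin 3)) 1)).toReal := ENNReal.toReal_nonneg
  nlinarith [mul_nonneg (mul_nonneg hΦ0 hκ) hV]

/-- **`P`, positive side**: `∫⁻ r² η₀⁺ ≤ ofReal (128 Φ κ V₁)`. -/
theorem ringDatum_rsq_posPart_le
    (hG : G = fun s => -κ * (Real.smoothTransition (s / t ^ 4 - 1) - Real.smoothTransition (s / 16 - 1)))
    (hF : F = fun s => ∫ τ in (32 : ℝ)..s, τ ^ (-(5 / 2 : ℝ)) * G τ) (ht : 0 < t) (ht1 : t ≤ 1)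
    (hκ : 0 ≤ κ) (hΦ : ∀ τ, |deriv Real.smoothTransition τ| ≤ Φ) :
    ∫⁻ x, ENNReal.ofReal (cylRadius x ^ 2 *
        (angVortQuot (curl fun y : EuclideanSpace ℝ (Fin 3) => F (‖y‖ ^ 2) • rotGen y) x)⁺) ≤
      ENNReal.ofReal (128 * Φ * κ * (volume (ball (0 : EuclideanSpace ℝ (Fin 3)) 1)).toReal) := by
  have hΦ0 : 0 ≤ Φ := (abs_nonneg _).trans (hΦ 0)
  have hMc : 0 ≤ 4 * Φ * κ / t ^ 10 := by positivity
  have h := lintegral_rsq_posPart_le (η := angVortQuot (curl fun y : EuclideanSpace ℝ (Fin 3) =>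
      F (‖y‖ ^ 2) • rotGen y)) (Mc := 4 * Φ * κ / t ^ 10) (ρc := 2 * t ^ 2) hMc (by positivity)
    (fun x => (abs_le.1 (ringDatum_abs_eta_le hG hF ht ht1 hκ hΦ x)).2)
    (fun x hx => ringDatum_eta_nonpos_of_lt hG hF ht ht1 hκ hx)
  refine h.trans (le_of_eq ?_)
  congr 1
  field_simp
  ring

/-- **`P`, negative side**: `∫⁻ r² η₀⁻ ≤ ofReal (128 Φ κ V₁)` (indeed `≤ (243/8) Φ κ V₁`). -/
theorem ringDatum_rsq_negPart_le
    (hG : G = fun s => -κ * (Real.smoothTransition (s / t ^ 4 - 1) - Real.smoothTransition (s / 16 - 1)))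
    (hF : F = fun s => ∫ τ in (32 : ℝ)..s, τ ^ (-(5 / 2 : ℝ)) * G τ) (ht : 0 < t) (ht1 : t ≤ 1)
    (hκ : 0 ≤ κ) (hΦ : ∀ τ, |deriv Real.smoothTransition τ| ≤ Φ) :
    ∫⁻ x, ENNReal.ofReal (cylRadius x ^ 2 *
        (angVortQuot (curl fun y : EuclideanSpace ℝ (Fin 3) => F (‖y‖ ^ 2) • rotGen y) x)⁻) ≤
      ENNReal.ofReal (128 * Φ * κ * (volume (ball (0 : EuclideanSpace ℝ (Fin 3)) 1)).toReal) := by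
  have hΦ0 : 0 ≤ Φ := (abs_nonneg _).trans (hΦ 0)
  have h := lintegral_rsq_negPart_le (η := angVortQuot (curl fun y : EuclideanSpace ℝ (Fin 3) =>
      F (‖y‖ ^ 2) • rotGen y)) (Ms := Φ * κ / 256) (ρs := 6) (by positivity) (by norm_num)
    (fun x => ringDatum_eta_lower hG hF ht ht1 hκ hΦ x)
    (fun x hx => ringDatum_eta_nonneg_of_six_lt hG hF ht ht1 hx)
  refine h.trans (ENNReal.ofReal_le_ofReal ?_)
  have hV : 0 ≤ (volume (ball (0 : EuclideanSpace ℝ (Fin 3)) 1)).toReal := ENNReal.toReal_nonneg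
  nlinarith [mul_nonneg (mul_nonneg hΦ0 hκ) hV]

/-- From `∫⁻ ofReal (η⁺) ≤ ofReal A` and `∫⁻ ofReal (η⁻) ≤ ofReal B` (`A, B ≥ 0`, `η ∈ L¹`):
`∫ |η| ≤ A + B`. -/
theorem integral_abs_le_of_parts {η : EuclideanSpace ℝ (Fin 3) → ℝ} (hη : Integrable η) {A B : ℝ}
    (hA : 0 ≤ A) (hB : 0 ≤ B) (hp : ∫⁻ x, ENNReal.ofReal ((η x)⁺) ≤ ENNReal.ofReal A)
    (hn : ∫⁻ x, ENNReal.ofReal ((η x)⁻) ≤ ENNReal.ofReal B) : ∫ x, |η x| ≤ A + B := by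
  have hpi : Integrable (fun x => (η x)⁺) := hη.pos_part
  have hni : Integrable (fun x => (η x)⁻) := hη.neg_part
  have e : (fun x => |η x|) = fun x => (η x)⁺ + (η x)⁻ := by
    funext x; exact (posPart_add_negPart (η x)).symm
  rw [e, integral_add hpi hni,
    integral_eq_lintegral_of_nonneg_ae (Filter.Eventually.of_forall fun x => posPart_nonneg _)
      hpi.aestronglyMeasurable,
    integral_eq_lintegral_of_nonneg_ae (Filter.Eventually.of_forall fun x => negPart_nonneg _)
      hni.aestronglyMeasurable]
  have h1 : (∫⁻ x, ENNReal.ofReal ((η x)⁺)).toReal ≤ A := by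
    have := ENNReal.toReal_mono ENNReal.ofReal_ne_top hp
    rwa [ENNReal.toReal_ofReal hA] at this
  have h2 : (∫⁻ x, ENNReal.ofReal ((η x)⁻)).toReal ≤ B := by
    have := ENNReal.toReal_mono ENNReal.ofReal_ne_top hn
    rwa [ENNReal.toReal_ofReal hB] at this
  exact add_le_add h1 h2

/-- **`m`**: `∫ |η₀| ≤ 32 Φ κ V₁ / t⁴ + Φ κ V₁`. -/
theorem ringDatum_mass_le
    (hG : G = fun s => -κ * (Real.smoothTransition (s / t ^ 4 - 1) - Real.smoothTransition (s / 16 - 1)))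
    (hF : F = fun s => ∫ τ in (32 : ℝ)..s, τ ^ (-(5 / 2 : ℝ)) * G τ) (ht : 0 < t) (ht1 : t ≤ 1)
    (hκ : 0 ≤ κ) (hΦ : ∀ τ, |deriv Real.smoothTransition τ| ≤ Φ) :
    ∫ x, |angVortQuot (curl fun y : EuclideanSpace ℝ (Fin 3) => F (‖y‖ ^ 2) • rotGen y) x| ≤
      32 * Φ * κ * (volume (ball (0 : EuclideanSpace ℝ (Fin 3)) 1)).toReal / t ^ 4 +
        Φ * κ * (volume (ball (0 : EuclideanSpace ℝ (Fin 3)) 1)).toReal := by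
  have hΦ0 : 0 ≤ Φ := (abs_nonneg _).trans (hΦ 0)
  have hV : 0 ≤ (volume (ball (0 : EuclideanSpace ℝ (Fin 3)) 1)).toReal := ENNReal.toReal_nonneg
  set η := angVortQuot (curl fun y : EuclideanSpace ℝ (Fin 3) => F (‖y‖ ^ 2) • rotGen y) with hη
  have hMc : 0 ≤ 4 * Φ * κ / t ^ 10 := by positivity
  -- positive part: sup `4Φκ/t¹⁰` on the ball of radius `2t²`
  have hp : ∫⁻ x, ENNReal.ofReal ((η x)⁺) ≤
      ENNReal.ofReal (4 * Φ * κ / t ^ 10 * (2 * t ^ 2) ^ 3 *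
        (volume (ball (0 : EuclideanSpace ℝ (Fin 3)) 1)).toReal) := by
    refine lintegral_ofReal_le_of_le_of_support hMc (by positivity) (fun x => ?_) (fun x hx => ?_)
    · rw [posPart_def]
      exact max_le (abs_le.1 (ringDatum_abs_eta_le hG hF ht ht1 hκ hΦ x)).2 hMc
    · rw [posPart_def]
      exact max_le (ringDatum_eta_nonpos_of_lt hG hF ht ht1 hκ hx) le_rfl
  -- negative part: sup `Φκ/256` on the ball of radius `6`
  have hn := lintegral_negPart_le (η := η) (Ms := Φ * κ / 256) (ρs := 6) (by positivity) (by norm_num)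
    (fun x => ringDatum_eta_lower hG hF ht ht1 hκ hΦ x)
    (fun x hx => ringDatum_eta_nonneg_of_six_lt hG hF ht ht1 hx)
  have h := integral_abs_le_of_parts (ringDatum_integrable hG hF ht ht1) (by positivity)
    (by positivity) hp hn
  refine h.trans ?_
  have e1 : 4 * Φ * κ / t ^ 10 * (2 * t ^ 2) ^ 3 * (volume (ball (0 : EuclideanSpace ℝ (Fin 3)) 1)).toReal =
      32 * Φ * κ * (volume (ball (0 : EuclideanSpace ℝ (Fin 3)) 1)).toReal / t ^ 4 := by
    have ht0 : t ≠ 0 := ht.ne'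
    field_simp
    ring
  rw [e1]
  have e2 : Φ * κ / 256 * 6 ^ 3 * (volume (ball (0 : EuclideanSpace ℝ (Fin 3)) 1)).toReal ≤
      Φ * κ * (volume (ball (0 : EuclideanSpace ℝ (Fin 3)) 1)).toReal := by
    nlinarith [mul_nonneg (mul_nonneg hΦ0 hκ) hV]
  linarith

end Datum

end Summit.NavierStokesRegularity.NavierStokesRegularity.Theorems.L3TimeExponentPincerRingDatumBounds
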